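import Summits.ResolutionOfSingularities.ResolutionOfSingularities.Theorems.PurelyInseparableDim4FlatAbsorbComm
import Summits.ResolutionOfSingularities.ResolutionOfSingularities.Theorems.PurelyInseparableDim4ChartClosureDegree
import HarnessLib

/-!
# Purely inseparable four-folds: a WAITING MEMBER stays permissible through a blow-up of a centre it meets, in every chart
# off its own variables (brick S3 (c) «joint point∘coordinate chains», part 31 = v3 spec (a1), algebraic half; cell `res-dim4-pi`)

[OURS · counted 0] (D-0157 DOOR 2; desk WORD #66 (4)(c), #74 (g), #99 (d); frame `PIDim4.TerminationImpliesOrderReduction`,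
S3 (c) v3 = «waiting members» of the joint forest, memo `S3c-V3-DESIGN.md`; host item stmt-ResolutionOfSingularities-16155,
helper). Nothing here proves resolution of singularities in dimension ≥ 4 / characteristic `p` — NOT here, not anywhere in
this programme.

The v2 joint forest blows up ONE member `V(z, x_S)` of the root locus and plans its children INSIDE the exceptional divisor
(`S ⊆ S″`). When the root locus has INTERSECTING components, the other components WAIT: a waiting member is a translated
coordinate subspace `V(z, x_i − c_i : i ∈ T)` meeting the centre (`c_i = 0` on `T ∩ S`), and in the chart `y_j` (`j ∈ S`,
`j ∉ T`) of the blow-up its strict transform is again `V(z, y_i − c_i : i ∈ T)` (`x_i = y_i y_j` on `S ∖ j`, `x_i = y_i` off `S`).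
THIS FILE is the ALGEBRAIC half of that survival: permissibility of `T` is KEPT by the tree's step
`step p S j c = clean ∘ translate_c ∘ chart_j` whenever `j ∉ T` and the translation `c` vanishes on `S`:

* `isPermissibleCentre_chartTransform_of_not_mem` — the chart law changes only the `y_j`-exponent, so for `j ∉ T` the `T`-degree
  of every monomial is unchanged: `q ≤ ord_T P ⇒ q ≤ ord_T (chart_j P)` (ANY `S`);
* **`isPermissibleCentre_step_of_not_mem`** — `j ∈ S`, `j ∉ T`, `c|_S = 0`, `T` permissible for `F(x + c)` ⇒ `T` permissible for
  `(step p S j c (F, …)).F` (commutation `chart_j ∘ translate_c = translate_c ∘ chart_j` = `FlatAbsorb.chartTransform_translate_of_forall`,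
  cleaning = `FlatAbsorb.isPermissibleCentre_deletePthPowers_translate`).

This is the `hP1`-permissibility input of a v3 plan entry `(j, c, T)` with `S ⊄ T` (the geometric half — the entry's centre IS the
strict transform of the waiting member, SNC with the new boundary — is typ-2's atlas/`S.erase j ⊆ S′` packages).

AI-produced formalisation, weaker than expert review. bears_on: LADDER-RESOLUTION:D157-DOOR2 (res-dim4-pi · S3 (c) joint v3 · waiting
members).
-/

set_option linter.dupNamespace false -- D-0017: single-problem summit path `Summit.<S>.<S>.…` by design

noncomputable section

open MvPolynomial Finset

namespace Summit.ResolutionOfSingularities.ResolutionOfSingularities.Theorems.PIDim4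

open Literature.AlgebraicGeometry.Resolution
open Literature.AlgebraicGeometry.Resolution.Hauser2010

namespace Equimultiple

section Waiting

variable {K : Type} [Field K]

/-- **The chart law keeps the `T`-degree of every monomial when `j ∉ T`**, hence `T`-permissibility: `q' ≤ ord_T P ⇒ q' ≤ ord_T (chart_j P)`
(any centre `S`, any chart exponent shift `q`). [cite: HauserPerlega2019PRIMS, §2 (the blowup in the x₁-chart; ord_P)] -/
theorem isPermissibleCentre_chartTransform_of_not_mem (q q' : ℕ) (S : Finset (Fin 4)) {T : Finset (Fin 4)} {j : Fin 4} (hjT : j ∉ T)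
    {P : MvPolynomial (Fin 4) K} (hP : IsPermissibleCentre q' T P) :
    IsPermissibleCentre q' T (CentreBlowup.chartTransform q S j P) := by
  classical
  refine ⟨hP.1, CentreBlowup.le_ordAlong_iff.mpr fun d hd => ?_⟩
  obtain ⟨e, he, rfl⟩ := ChartDictionary.exists_chartExponent_eq_of_mem_support q S j P hd
  have hdeg : CentreBlowup.degIn T (CentreBlowup.chartExponent q S j e) = CentreBlowup.degIn T e := by
    unfold CentreBlowup.degIn
    refine Finset.sum_congr rfl fun i hi => ?_
    exact CentreBlowup.chartExponent_apply_of_ne q S (fun h => hjT (by rw [h] at hi; exact hi)) e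
  rw [hdeg]
  exact CentreBlowup.le_ordAlong_iff.mp hP.2 e he

/-- **A WAITING MEMBER STAYS PERMISSIBLE THROUGH THE STEP** (`j ∈ S`, `j ∉ T`, `c|_S = 0`): if `V(z, x_T)` is Hironaka-permissible for
`z^p + F(x + c)` then it is Hironaka-permissible for the cleaned chart state `(step p S j c (F, …)).F = clean((chart_j F)(y + c))`.
[cite: HauserPerlega2019PRIMS, §2 (the blowup in the x₁-chart; cleaning)] [cite: Hauser2010, §§F–G] -/
theorem isPermissibleCentre_step_of_not_mem [DecidableEq K] {p : ℕ} {S T : Finset (Fin 4)} {j : Fin 4} (hj : j ∈ S) (hjT : j ∉ T)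
    {c : Fin 4 → K} (hc : ∀ i ∈ S, c i = 0) (s : State K) (hT : IsPermissibleCentre p T (PointBlowup.translate c s.F)) :
    IsPermissibleCentre p T (CentreBlowup.step p S j c s).F := by
  have hF : (CentreBlowup.step p S j c s).F =
      deletePthPowers p (PointBlowup.translate 0 (CentreBlowup.chartTransform p S j (PointBlowup.translate c s.F))) := by
    rw [PointBlowup.translate_zero, FlatAbsorb.chartTransform_translate_of_forall hj hc]
    rfl
  rw [hF]
  exact FlatAbsorb.isPermissibleCentre_deletePthPowers_translate (v := 0) (fun _ _ => rfl)
    (isPermissibleCentre_chartTransform_of_not_mem p p S hjT hT)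

/-- **The same for a waiting member given at the root in its own position**: `W = V(z, x_i − w_i : i ∈ T)` meeting the centre
(`w_i = 0` on `T ∩ S`) and permissible for `z^p + F` (i.e. `T` permissible for `F(x + w)`); blowing up `V(z, x_S)` and reading the chart `y_j`
(`j ∈ S ∖ T`) at the point `c = w` off `S`, `c = 0` on `S`, the subspace `V(z, y_T)` re-centred at `c` is permissible for the new state.
[cite: HauserPerlega2019PRIMS, §2] [cite: Hauser2010, §§F–G] -/
theorem isPermissibleCentre_step_of_waiting [DecidableEq K] {p : ℕ} {S T : Finset (Fin 4)} {j : Fin 4} (hj : j ∈ S) (hjT : j ∉ T)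
    {w : Fin 4 → K} (hw : ∀ i ∈ T, i ∈ S → w i = 0) (hwS : ∀ i ∉ T, w i = 0) (s : State K)
    (hT : IsPermissibleCentre p T (PointBlowup.translate w s.F)) :
    IsPermissibleCentre p T (CentreBlowup.step p S j w s).F := by
  refine isPermissibleCentre_step_of_not_mem hj hjT (fun i hi => ?_) s hT
  by_cases hiT : i ∈ T
  · exact hw i hiT hi
  · exact hwS i hiT

/-! ## §2 The waiting entry point is equimultiple (appended) -/

/-- **Permissibility of any `T` for the point transform forces the pair `(j, c)` to be equimultiple**: every monomial of the
translated chart transform has `T`-degree `≥ p`, hence degree `≥ p`. [cite: Hauser2010, §F (equiconstant points)] -/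
theorem isEquimultiplePoint_of_isPermissibleCentre_pointTransform [DecidableEq K] {p : ℕ} {S T : Finset (Fin 4)} {j : Fin 4}
    {c : Fin 4 → K} (s : State K) (h : IsPermissibleCentre p T (CentreBlowup.pointTransform p S j c s)) :
    CentreBlowup.IsEquimultiplePoint p S j c s := by
  intro d hd hdp
  by_contra hne
  have h1 := CentreBlowup.le_ordAlong_iff.mp h.2 d (MvPolynomial.mem_support_iff.mpr hne)
  have h2 : CentreBlowup.degIn T d ≤ d.degree := by
    rw [← CentreBlowup.degIn_univ]
    exact Finset.sum_le_sum_of_subset (Finset.subset_univ T)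
  have h3 : p ≤ CentreBlowup.degIn T d := by exact_mod_cast h1
  omega

/-- **THE WAITING ENTRY `(j, c, T)` IS AN EQUIMULTIPLE PAIR** (`j ∈ S`, `j ∉ T`, `c|_S = 0`, `T` permissible for `F(x + c)`): the
`IsEquimultiplePoint` conjunct of the forest's `hP1` for a waiting member. [cite: Hauser2010, §F (equiconstant points)]
[cite: HauserPerlega2019PRIMS, §2] -/
theorem isEquimultiplePoint_of_waiting [DecidableEq K] {p : ℕ} {S T : Finset (Fin 4)} {j : Fin 4} (hj : j ∈ S) (hjT : j ∉ T)
    {c : Fin 4 → K} (hc : ∀ i ∈ S, c i = 0) (s : State K) (hT : IsPermissibleCentre p T (PointBlowup.translate c s.F)) :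
    CentreBlowup.IsEquimultiplePoint p S j c s := by
  refine isEquimultiplePoint_of_isPermissibleCentre_pointTransform s (T := T) ?_
  show IsPermissibleCentre p T (PointBlowup.translate c (CentreBlowup.chartTransform p S j s.F))
  rw [← FlatAbsorb.chartTransform_translate_of_forall hj hc]
  exact isPermissibleCentre_chartTransform_of_not_mem p p S hjT hT

/-! ## §3 The equation vanishes on a waiting member (appended) -/

/-- `F(x + c)` evaluated at `v` is `F` evaluated at `v + c`. [folklore] -/
theorem eval_translate_eq (c v : Fin 4 → K) (F : MvPolynomial (Fin 4) K) :
    eval v (PointBlowup.translate c F) = eval (v + c) F := by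
  unfold PointBlowup.translate
  induction F using MvPolynomial.induction_on with
  | C a => simp
  | add f g hf hg => rw [map_add, map_add, hf, hg, map_add]
  | mul_X f i hf => rw [map_mul, map_mul, hf, aeval_X, map_mul, eval_X, map_add, eval_X, eval_C, Pi.add_apply]

/-- **The equation vanishes identically on a permissible translated coordinate subspace**: if `V(z, x_T)` is permissible for
`z^p + F(x + c)` (`p ≥ 1`) then `F(b) = 0` for every `b` agreeing with `c` on `T` — so the order-`p` points of `z^p + F` over the
waiting member have `z = 0`. [cite: HauserPerlega2019PRIMS, §2 (condition (1))] -/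
theorem eval_eq_zero_of_isPermissibleCentre_translate {p : ℕ} (hp : 0 < p) {T : Finset (Fin 4)} {c b : Fin 4 → K}
    {F : MvPolynomial (Fin 4) K} (hT : IsPermissibleCentre p T (PointBlowup.translate c F)) (hb : ∀ i ∈ T, b i = c i) :
    eval b F = 0 := by
  classical
  have hbc : b = (b - c) + c := by rw [sub_add_cancel]
  rw [hbc, ← eval_translate_eq, MvPolynomial.eval_eq]
  refine Finset.sum_eq_zero fun d hd => ?_
  -- a `T`-variable occurs in `d`
  have hdeg : p ≤ CentreBlowup.degIn T d := by exact_mod_cast CentreBlowup.le_ordAlong_iff.mp hT.2 d hd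
  obtain ⟨i, hiT, hi⟩ : ∃ i ∈ T, d i ≠ 0 := by
    by_contra h
    push Not at h
    have : CentreBlowup.degIn T d = 0 := Finset.sum_eq_zero h
    omega
  rw [Finset.prod_eq_zero (Finsupp.mem_support_iff.mpr hi) (by rw [Pi.sub_apply, hb i hiT, sub_self, zero_pow hi]), mul_zero]

end Waiting

end Equimultiple

end Summit.ResolutionOfSingularities.ResolutionOfSingularities.Theorems.PIDim4

end
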